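import Summits.CriticalPhenomena.PercolationContinuityZ3.Theorems.PercNearOneGluingNoHeavyLowerTailFKQSensitivityWitnesses
import HarnessLib

/-!
# Non-locality of `φ_{w,q}` on the triangle for EVERY `q ≠ 1` (symbolic companion of `FK.rcMeasureW_two_nonlocal`)

Helper file (`--supports stmt-CriticalPhenomena-4575 --as helper`), FK sub-lane `prim-bschramm-fk-3` ("locate the `q`-sensitivity");
builds on p205010 (kernel theorem, internal audit signed; external expert review pending).  No named facts, no sorries; standard axioms.

`…FKQSensitivityWitnesses.lean` certified the row-F/G mechanism of bschramm/FK-BARRIER.md §0 at ONE value, `q = 2` (`5/14 ≠ 1/3`).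
The barrier memo's claim is stronger: the locality / restriction identities of block (D) are `q = 1`-ONLY identities — false for
EVERY `q ≠ 1`.  This file proves that claim on the smallest graph, symbolically in `p` and `q`:

* a real-parameter variant of the bridge (`RCEval.wR`, `RCEval.mR`, `RCEval.real_eq_sum_div_R`: the parameter vector with REAL
  entries `cr i ∈ [0,1]` on the listed pairs of a valid shape `D`, evaluated as `φ(X) = (Σ_t mR t·[conf t ∈ X]) / Σ_t mR t` with
  `mR t = (∏_i (cr i | 1 − cr i)) · q^{kB t}` — same transfer argument as `RCEval.real_eq_massQ_div`, but `Finset.sum` expansions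
  instead of `decide`);
* the closed forms on `K₃` (shape `QSensitivity.k3 1`): with parameters `(p,p,p)`,
  `Z = (1−p)³q³ + 3p(1−p)²q² + 3p²(1−p)q + p³q`, `Z·φ(01 open) = p(1−p)²q² + 2p²(1−p)q + p³q`; with parameters `(p,p,0)` (the pair `12`
  deleted), `Z' = (1−p)²q³ + 2p(1−p)q² + p²q`, `Z'·φ'(01 open) = p(1−p)q² + p²q`;
* **`FK.rcMeasureW_k3_nonlocal_iff`**: for `0 < p < 1` and `0 < q`, `φ_{K₃,p,q}(01 open) = φ_{K₃−12,p,q}(01 open) ↔ q = 1`, from the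
  polynomial identity `W·Z' − W'·Z = p³(1−p)q²(q−1)((1−p)q + p)` (`FK.k3_nonlocal_cross_sub`); and **`FK.rcMeasureW_k3_nonlocal_sign`**:
  the difference `φ_{K₃}(01) − φ_{K₃−12}(01)` has the sign of `q − 1` (positive association raises, negative lowers, the density of
  `01` when the third edge is present).
So on `K₃` the marginal law of one pair is local (independent of the parameter of another pair) EXACTLY at `q = 1` — the product
measure's `prodBernoulli_real_eq_of_determinedBy` — and at no other `q > 0`.
[cite: Grimmett2006, §1.4 eq. (1.20) (p. 15); Lemma (4.13); Thm. (3.8)] [cite: KozmaNitzan2024, Conj. 1 (p. 3)]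
-/

namespace Summit.CriticalPhenomena.PercolationContinuityZ3.Theorems

namespace FK

open MeasureTheory Literature.Probability.LatticeModels Literature.Probability.Percolation
open Literature.Probability.Percolation.BHK2006 (weight)
open Literature.Probability.Percolation.DecisionTree (ind ind_of_mem ind_of_not_mem)

/-! ### Real-parameter evaluation on a valid shape -/

namespace RCEval

noncomputable section

open scoped Classical

variable (D : RCEval)

/-- The parameter vector with REAL entries `cr i` on the listed pairs of the shape `D` (`0` elsewhere; clamped into `[0,1]`).
[cite: Grimmett2006, §1.4 eq. (1.20) (p. 15)] -/
def wR (cr : Fin D.m → ℝ) (e : Sym2 (Fin D.n)) : unitInterval :=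
  ⟨max 0 (min 1 (∑ i ∈ Finset.univ.filter (fun i => D.edge i = e), cr i)),
    ⟨le_max_left _ _, max_le zero_le_one (min_le_left _ _)⟩⟩

/-- The real random-cluster weight `mR t = (∏_i (cr i if open else 1 − cr i)) · q^{kB t}` of the configuration `conf t`.
[cite: Grimmett2006, §1.4 eq. (1.20) (p. 15)] -/
def mR (cr : Fin D.m → ℝ) (qr : ℝ) (t : Finset (Fin D.m)) : ℝ := (∏ i : Fin D.m, if i ∈ t then cr i else 1 - cr i) * qr ^ D.kB t

variable {D}

/-- The parameter of the listed pair `edge i` is `cr i` (shape valid, `cr ∈ [0,1]`). [folklore] -/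
theorem wR_edge (hD : D.Valid) {cr : Fin D.m → ℝ} (hc : ∀ i, 0 ≤ cr i ∧ cr i ≤ 1) (i : Fin D.m) :
    (D.wR cr (D.edge i) : ℝ) = cr i := by
  have hfilter : (Finset.univ.filter fun j => D.edge j = D.edge i) = {i} := by
    ext j
    simp only [Finset.mem_filter, Finset.mem_univ, true_and, Finset.mem_singleton]
    exact ⟨fun h => hD.1 h, fun h => h ▸ rfl⟩
  change max 0 (min 1 _) = _
  rw [hfilter, Finset.sum_singleton, min_eq_right (hc i).2, max_eq_right (hc i).1]

/-- An unlisted pair has parameter `0`. [folklore] -/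
theorem wR_eq_zero_of_notMem_range (cr : Fin D.m → ℝ) {e : Sym2 (Fin D.n)} (he : e ∉ Set.range D.edge) :
    (D.wR cr e : ℝ) = 0 := by
  have hfilter : (Finset.univ.filter fun j => D.edge j = e) = ∅ := by
    ext j
    simp only [Finset.mem_filter, Finset.mem_univ, true_and, Finset.notMem_empty, iff_false]
    exact fun h => he ⟨j, h⟩
  change max 0 (min 1 _) = _
  rw [hfilter, Finset.sum_empty, min_eq_right zero_le_one, max_self]

/-- The random-cluster weight of `conf t` is `mR t`. [cite: Grimmett2006, §1.4 eq. (1.20) (p. 15)] -/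
theorem rcWeightW_conf_R (hD : D.Valid) {cr : Fin D.m → ℝ} (hc : ∀ i, 0 ≤ cr i ∧ cr i ≤ 1) (qr : ℝ) (t : Finset (Fin D.m)) :
    rcWeightW (D.wR cr) qr ∅ (D.conf t) = D.mR cr qr t := by
  unfold rcWeightW mR weight
  rw [clusterCount_conf t]
  congr 1
  have hsub : Finset.univ.image D.edge ⊆ (Finset.univ : Finset (Sym2 (Fin D.n))) := Finset.subset_univ _
  rw [← Finset.prod_subset hsub]
  · rw [Finset.prod_image fun i _ j _ h => hD.1 h]
    refine Finset.prod_congr rfl fun i _ => ?_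
    dsimp only
    rw [wR_edge hD hc i]
    by_cases hi : i ∈ t
    · rw [if_pos ((edge_mem_conf hD t i).2 hi), if_pos hi]
    · rw [if_neg (fun h => hi ((edge_mem_conf hD t i).1 h)), if_neg hi]
  · intro e _ he
    have he' : e ∉ Set.range D.edge := by
      rintro ⟨i, rfl⟩
      exact he (Finset.mem_image.2 ⟨i, Finset.mem_univ _, rfl⟩)
    dsimp only
    rw [if_neg (fun h => he' (conf_subset_range t h)), wR_eq_zero_of_notMem_range cr he', sub_zero]

/-- A configuration using an unlisted pair has weight `0`. [cite: Grimmett2006, §1.4 eq. (1.20) (p. 15)] -/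
theorem rcWeightW_eq_zero_R (cr : Fin D.m → ℝ) (qr : ℝ) {ω : BondConfig (Fin D.n)} (hω : ¬ ω ⊆ Set.range D.edge) :
    rcWeightW (D.wR cr) qr ∅ ω = 0 := by
  obtain ⟨e, heω, he⟩ := Set.not_subset.1 hω
  unfold rcWeightW weight
  rw [Finset.prod_eq_zero (Finset.mem_univ e) (by dsimp only; rw [if_pos heω, wR_eq_zero_of_notMem_range cr he]), zero_mul]

/-- **Transfer** (real parameters): `Σ_ω w_q(ω) f(ω) = Σ_t mR t · f(conf t)`. [cite: Grimmett2006, §1.4 eq. (1.20) (p. 15)] -/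
theorem sum_rcWeightW_mul_R (hD : D.Valid) {cr : Fin D.m → ℝ} (hc : ∀ i, 0 ≤ cr i ∧ cr i ≤ 1) (qr : ℝ)
    (f : BondConfig (Fin D.n) → ℝ) :
    ∑ ω : BondConfig (Fin D.n), rcWeightW (D.wR cr) qr ∅ ω * f ω = ∑ t : Finset (Fin D.m), D.mR cr qr t * f (D.conf t) := by
  have hsub : Finset.univ.image D.conf ⊆ (Finset.univ : Finset (BondConfig (Fin D.n))) := Finset.subset_univ _
  rw [← Finset.sum_subset hsub]
  · rw [Finset.sum_image fun s _ t _ h => conf_injective hD h]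
    exact Finset.sum_congr rfl fun t _ => by rw [rcWeightW_conf_R hD hc qr t]
  · intro ω _ hω
    have hω' : ¬ ω ⊆ Set.range D.edge := by
      intro h
      obtain ⟨t, rfl⟩ := exists_conf_eq_of_subset h
      exact hω (Finset.mem_image.2 ⟨t, Finset.mem_univ _, rfl⟩)
    rw [rcWeightW_eq_zero_R cr qr hω', zero_mul]

/-- **Evaluation** (real parameters): `φ(X) = (Σ_t mR t · 1_X(conf t)) / Σ_t mR t`. [cite: Grimmett2006, §1.4 eq. (1.20) (p. 15)] -/
theorem real_eq_sum_div_R (hD : D.Valid) {cr : Fin D.m → ℝ} (hc : ∀ i, 0 ≤ cr i ∧ cr i ≤ 1) {qr : ℝ} (hq : 0 < qr)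
    (X : Set (BondConfig (Fin D.n))) :
    (rcMeasureW (D.wR cr) qr ∅).real X =
      (∑ t : Finset (Fin D.m), D.mR cr qr t * ind X (D.conf t)) / ∑ t : Finset (Fin D.m), D.mR cr qr t := by
  rw [rcMeasureW_real_eq_sum_div (D.wR cr) hq ∅ X, sum_rcWeightW_mul_R hD hc qr]
  unfold rcPartitionFunctionW
  have h := sum_rcWeightW_mul_R hD hc qr (fun _ => 1)
  simp only [mul_one] at h
  rw [h]

end

end RCEval

/-! ### The triangle: closed forms in `p` and `q` -/

namespace QSensitivity

noncomputable section

open scoped Classical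

/-- Parameters `(p, p, p)` on the listed pairs `01, 02, 12` of the shape `k3 1`. [folklore] -/
def crK3 (p : ℝ) : Fin 3 → ℝ := fun _ => p

/-- Parameters `(p, p, 0)`: the pair `12` deleted. [folklore] -/
def crDel (p : ℝ) : Fin 3 → ℝ := fun i => if i = 2 then 0 else p

/-- The eight subsets of `Fin 3`. [folklore] -/
theorem univ_finset_fin3 :
    (Finset.univ : Finset (Finset (Fin 3))) = {∅, {0}, {1}, {2}, {0, 1}, {0, 2}, {1, 2}, {0, 1, 2}} := by decide

/-- The cluster counts of the eight configurations of the triangle. [folklore] -/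
theorem k3_kB_vals :
    (k3 1).kB ∅ = 3 ∧ (k3 1).kB {0} = 2 ∧ (k3 1).kB {1} = 2 ∧ (k3 1).kB {2} = 2 ∧ (k3 1).kB {0, 1} = 1 ∧ (k3 1).kB {0, 2} = 1 ∧
      (k3 1).kB {1, 2} = 1 ∧ (k3 1).kB {0, 1, 2} = 1 := by
  decide

/-- A sum over the eight subsets of `Fin 3`, written out. [folklore] -/
theorem sum_finset_fin3 (F : Finset (Fin 3) → ℝ) :
    ∑ t : Finset (Fin 3), F t = F ∅ + F {0} + F {1} + F {2} + F {0, 1} + F {0, 2} + F {1, 2} + F {0, 1, 2} := by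
  rw [univ_finset_fin3]
  rw [Finset.sum_insert (by decide), Finset.sum_insert (by decide), Finset.sum_insert (by decide), Finset.sum_insert (by decide),
    Finset.sum_insert (by decide), Finset.sum_insert (by decide), Finset.sum_insert (by decide), Finset.sum_singleton]
  ring

/-- `Z(K₃; p, q) = (1−p)³q³ + 3p(1−p)²q² + 3p²(1−p)q + p³q`. (transcription of bschramm/FK-BARRIER.md §9) -/
theorem sum_mR_k3 (p q : ℝ) : ∑ t : Finset (Fin 3), (k3 1).mR (crK3 p) q t =
    (1 - p) ^ 3 * q ^ 3 + 3 * p * (1 - p) ^ 2 * q ^ 2 + 3 * p ^ 2 * (1 - p) * q + p ^ 3 * q := by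
  obtain ⟨h0, h1, h2, h3, h4, h5, h6, h7⟩ := k3_kB_vals
  rw [sum_finset_fin3]
  simp +decide only [RCEval.mR, Fin.prod_univ_three, crK3, h0, h1, h2, h3, h4, h5, h6, h7, Finset.mem_insert,
    Finset.mem_singleton, Finset.notMem_empty, if_true, if_false]
  ring

/-- `Z·φ_{K₃}(01 open) = p(1−p)²q² + 2p²(1−p)q + p³q`. (transcription of bschramm/FK-BARRIER.md §9) -/
theorem sum_mR_k3_e0 (p q : ℝ) :
    ∑ t : Finset (Fin 3), (k3 1).mR (crK3 p) q t * ind {ω : BondConfig (Fin 3) | s((0 : Fin 3), 1) ∈ ω} ((k3 1).conf t) =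
      p * (1 - p) ^ 2 * q ^ 2 + 2 * p ^ 2 * (1 - p) * q + p ^ 3 * q := by
  obtain ⟨h0, h1, h2, h3, h4, h5, h6, h7⟩ := k3_kB_vals
  have hind : ∀ t : Finset (Fin 3), ind {ω : BondConfig (Fin 3) | s((0 : Fin 3), 1) ∈ ω} ((k3 1).conf t) =
      if (0 : Fin 3) ∈ t then 1 else 0 := by
    intro t
    by_cases ht : (0 : Fin 3) ∈ t
    · rw [if_pos ht, ind_of_mem ((k3_conf_mem_e0 k3_one_valid t).2 (decide_eq_true ht))]
    · rw [if_neg ht, ind_of_not_mem (fun h => ht (of_decide_eq_true ((k3_conf_mem_e0 k3_one_valid t).1 h)))]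
  simp only [hind]
  rw [sum_finset_fin3]
  simp +decide only [RCEval.mR, Fin.prod_univ_three, crK3, h0, h1, h2, h3, h4, h5, h6, h7, Finset.mem_insert,
    Finset.mem_singleton, Finset.notMem_empty, if_true, if_false]
  ring

/-- `Z(K₃ − 12; p, q) = (1−p)²q³ + 2p(1−p)q² + p²q`. (transcription of bschramm/FK-BARRIER.md §9) -/
theorem sum_mR_k3del (p q : ℝ) : ∑ t : Finset (Fin 3), (k3 1).mR (crDel p) q t =
    (1 - p) ^ 2 * q ^ 3 + 2 * p * (1 - p) * q ^ 2 + p ^ 2 * q := by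
  obtain ⟨h0, h1, h2, h3, h4, h5, h6, h7⟩ := k3_kB_vals
  rw [sum_finset_fin3]
  simp +decide only [RCEval.mR, Fin.prod_univ_three, crDel, h0, h1, h2, h3, h4, h5, h6, h7, Finset.mem_insert,
    Finset.mem_singleton, Finset.notMem_empty, if_true, if_false]
  ring

/-- `Z'·φ_{K₃−12}(01 open) = p(1−p)q² + p²q`. (transcription of bschramm/FK-BARRIER.md §9) -/
theorem sum_mR_k3del_e0 (p q : ℝ) :
    ∑ t : Finset (Fin 3), (k3 1).mR (crDel p) q t * ind {ω : BondConfig (Fin 3) | s((0 : Fin 3), 1) ∈ ω} ((k3 1).conf t) =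
      p * (1 - p) * q ^ 2 + p ^ 2 * q := by
  obtain ⟨h0, h1, h2, h3, h4, h5, h6, h7⟩ := k3_kB_vals
  have hind : ∀ t : Finset (Fin 3), ind {ω : BondConfig (Fin 3) | s((0 : Fin 3), 1) ∈ ω} ((k3 1).conf t) =
      if (0 : Fin 3) ∈ t then 1 else 0 := by
    intro t
    by_cases ht : (0 : Fin 3) ∈ t
    · rw [if_pos ht, ind_of_mem ((k3_conf_mem_e0 k3_one_valid t).2 (decide_eq_true ht))]
    · rw [if_neg ht, ind_of_not_mem (fun h => ht (of_decide_eq_true ((k3_conf_mem_e0 k3_one_valid t).1 h)))]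
  simp only [hind]
  rw [sum_finset_fin3]
  simp +decide only [RCEval.mR, Fin.prod_univ_three, crDel, h0, h1, h2, h3, h4, h5, h6, h7, Finset.mem_insert,
    Finset.mem_singleton, Finset.notMem_empty, if_true, if_false]
  ring

/-- `φ_{K₃,p,q}(01 open)` in closed form. [cite: Grimmett2006, §1.4 eq. (1.20) (p. 15)] -/
theorem real_k3R_e0 {p q : ℝ} (hp0 : 0 ≤ p) (hp1 : p ≤ 1) (hq : 0 < q) :
    (rcMeasureW ((k3 1).wR (crK3 p)) q ∅).real {ω : BondConfig (Fin 3) | s((0 : Fin 3), 1) ∈ ω} =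
      (p * (1 - p) ^ 2 * q ^ 2 + 2 * p ^ 2 * (1 - p) * q + p ^ 3 * q) /
        ((1 - p) ^ 3 * q ^ 3 + 3 * p * (1 - p) ^ 2 * q ^ 2 + 3 * p ^ 2 * (1 - p) * q + p ^ 3 * q) := by
  rw [RCEval.real_eq_sum_div_R (cr := crK3 p) k3_one_valid (fun _ => ⟨hp0, hp1⟩) hq, sum_mR_k3_e0, sum_mR_k3]

/-- `φ_{K₃−12,p,q}(01 open)` in closed form. [cite: Grimmett2006, §1.4 eq. (1.20) (p. 15)] -/
theorem real_k3delR_e0 {p q : ℝ} (hp0 : 0 ≤ p) (hp1 : p ≤ 1) (hq : 0 < q) :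
    (rcMeasureW ((k3 1).wR (crDel p)) q ∅).real {ω : BondConfig (Fin 3) | s((0 : Fin 3), 1) ∈ ω} =
      (p * (1 - p) * q ^ 2 + p ^ 2 * q) / ((1 - p) ^ 2 * q ^ 3 + 2 * p * (1 - p) * q ^ 2 + p ^ 2 * q) := by
  have hc : ∀ i : Fin 3, 0 ≤ crDel p i ∧ crDel p i ≤ 1 := by
    intro i; unfold crDel; split_ifs
    · exact ⟨le_rfl, zero_le_one⟩
    · exact ⟨hp0, hp1⟩
  rw [RCEval.real_eq_sum_div_R (cr := crDel p) k3_one_valid hc hq, sum_mR_k3del_e0, sum_mR_k3del]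

/-- The two parameter vectors agree off the pair `12` (valid shape, `p ∈ [0,1]`). [folklore] -/
theorem wR_crK3_eq_crDel {p : ℝ} (hp0 : 0 ≤ p) (hp1 : p ≤ 1) {e : Sym2 (Fin 3)} (he : e ≠ s((1 : Fin 3), 2)) :
    (k3 1).wR (crK3 p) e = (k3 1).wR (crDel p) e := by
  have hc1 : ∀ i : Fin 3, 0 ≤ crK3 p i ∧ crK3 p i ≤ 1 := fun _ => ⟨hp0, hp1⟩
  have hc2 : ∀ i : Fin 3, 0 ≤ crDel p i ∧ crDel p i ≤ 1 := by
    intro i; unfold crDel; split_ifs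
    · exact ⟨le_rfl, zero_le_one⟩
    · exact ⟨hp0, hp1⟩
  apply Subtype.ext
  by_cases hr : e ∈ Set.range (k3 1).edge
  · obtain ⟨i, rfl⟩ := hr
    rw [RCEval.wR_edge k3_one_valid hc1 i, RCEval.wR_edge k3_one_valid hc2 i]
    fin_cases i
    · rfl
    · rfl
    · exact (he rfl).elim
  · rw [RCEval.wR_eq_zero_of_notMem_range _ hr, RCEval.wR_eq_zero_of_notMem_range _ hr]

end

end QSensitivity

/-! ### Non-locality for every `q ≠ 1` -/

noncomputable section

open scoped Classical
open QSensitivity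

/-- The cross difference of the two closed forms: `W·Z' − W'·Z = p³(1−p)q²(q−1)((1−p)q + p)`. [folklore] -/
theorem k3_nonlocal_cross_sub (p q : ℝ) :
    (p * (1 - p) ^ 2 * q ^ 2 + 2 * p ^ 2 * (1 - p) * q + p ^ 3 * q) *
        ((1 - p) ^ 2 * q ^ 3 + 2 * p * (1 - p) * q ^ 2 + p ^ 2 * q) -
      (p * (1 - p) * q ^ 2 + p ^ 2 * q) *
        ((1 - p) ^ 3 * q ^ 3 + 3 * p * (1 - p) ^ 2 * q ^ 2 + 3 * p ^ 2 * (1 - p) * q + p ^ 3 * q) =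
    p ^ 3 * (1 - p) * q ^ 2 * (q - 1) * ((1 - p) * q + p) := by
  ring

/-- **Non-locality on `K₃` has the sign of `q − 1`.**  For `0 < p < 1`, `0 < q`: the probability that `01` is open under
`φ_{K₃,p,q}` minus the same probability after deleting the pair `12` is positive for `q > 1`, zero for `q = 1`, negative for
`q < 1` — precisely, it equals `p³(1−p)q²(q−1)((1−p)q+p)/(Z·Z')` with `Z, Z' > 0`.
[cite: Grimmett2006, Thm. (3.8), Lemma (4.13), §3.9] -/
theorem rcMeasureW_k3_nonlocal_sign {p q : ℝ} (hp0 : 0 < p) (hp1 : p < 1) (hq : 0 < q) :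
    (rcMeasureW ((k3 1).wR (crK3 p)) q ∅).real {ω : BondConfig (Fin 3) | s((0 : Fin 3), 1) ∈ ω} -
        (rcMeasureW ((k3 1).wR (crDel p)) q ∅).real {ω : BondConfig (Fin 3) | s((0 : Fin 3), 1) ∈ ω} =
      p ^ 3 * (1 - p) * q ^ 2 * (q - 1) * ((1 - p) * q + p) /
        (((1 - p) ^ 3 * q ^ 3 + 3 * p * (1 - p) ^ 2 * q ^ 2 + 3 * p ^ 2 * (1 - p) * q + p ^ 3 * q) *
          ((1 - p) ^ 2 * q ^ 3 + 2 * p * (1 - p) * q ^ 2 + p ^ 2 * q)) := by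
  have h1p : 0 < 1 - p := sub_pos.2 hp1
  have hZ : 0 < (1 - p) ^ 3 * q ^ 3 + 3 * p * (1 - p) ^ 2 * q ^ 2 + 3 * p ^ 2 * (1 - p) * q + p ^ 3 * q := by positivity
  have hZ' : 0 < (1 - p) ^ 2 * q ^ 3 + 2 * p * (1 - p) * q ^ 2 + p ^ 2 * q := by positivity
  rw [real_k3R_e0 hp0.le hp1.le hq, real_k3delR_e0 hp0.le hp1.le hq, div_sub_div _ _ hZ.ne' hZ'.ne', ← k3_nonlocal_cross_sub]
  congr 1
  ring

/-- **The law of one pair is local EXACTLY at `q = 1`.**  On `Fin 3` with the valid shape `K₃`, parameters `p ∈ (0,1)` on `01, 02`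
and the pair `12` either at `p` or deleted (`0`), for every `q > 0`:
`φ_{K₃,p,q}(01 open) = φ_{K₃−12,p,q}(01 open) ↔ q = 1` — the two parameter vectors agree off `12` (`wR_crK3_eq_crDel`), the event is
determined by `01` alone, and the identity `prodBernoulli_real_eq_of_determinedBy` of the `q = 1` chain (block (D) of
bschramm/FK-BARRIER.md §0: locality transfer (i), restriction identity (iii)) holds at `q = 1` and at NO other `q`.
[cite: Grimmett2006, Lemma (4.13) and §1.4 eq. (1.20)] [cite: KozmaNitzan2024, Conj. 1 (p. 3)] -/
theorem rcMeasureW_k3_nonlocal_iff {p q : ℝ} (hp0 : 0 < p) (hp1 : p < 1) (hq : 0 < q) :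
    (rcMeasureW ((k3 1).wR (crK3 p)) q ∅).real {ω : BondConfig (Fin 3) | s((0 : Fin 3), 1) ∈ ω} =
        (rcMeasureW ((k3 1).wR (crDel p)) q ∅).real {ω : BondConfig (Fin 3) | s((0 : Fin 3), 1) ∈ ω} ↔ q = 1 := by
  have h1p : 0 < 1 - p := sub_pos.2 hp1
  have hZ : 0 < (1 - p) ^ 3 * q ^ 3 + 3 * p * (1 - p) ^ 2 * q ^ 2 + 3 * p ^ 2 * (1 - p) * q + p ^ 3 * q := by positivity
  have hZ' : 0 < (1 - p) ^ 2 * q ^ 3 + 2 * p * (1 - p) * q ^ 2 + p ^ 2 * q := by positivity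
  rw [← sub_eq_zero, rcMeasureW_k3_nonlocal_sign hp0 hp1 hq, div_eq_zero_iff]
  constructor
  · rintro (h | h)
    · have hne : p ^ 3 * (1 - p) * q ^ 2 * ((1 - p) * q + p) ≠ 0 := by positivity
      have : p ^ 3 * (1 - p) * q ^ 2 * (q - 1) * ((1 - p) * q + p) = (p ^ 3 * (1 - p) * q ^ 2 * ((1 - p) * q + p)) * (q - 1) := by
        ring
      rw [this] at h
      rcases mul_eq_zero.1 h with h' | h'
      · exact (hne h').elim
      · linarith
    · exact ((mul_pos hZ hZ').ne' h).elim
  · rintro rfl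
    left; ring

end

end FK

end Summit.CriticalPhenomena.PercolationContinuityZ3.Theorems
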